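import Mathlib.Analysis.SpecialFunctions.Exp
import Mathlib.Algebra.Order.BigOperators.Group.Finset
import Mathlib.Topology.Algebra.Order.LiminfLimsup
import HarnessLib

/-!
# THE FINITE-SUM ALGEBRA OF LOCALIZED SUMS: PINNED CANCELLATION AND «POLYMER NORM ⇒ PINNED SUMS» (abstract, model-free)

Cell `ym3-torus` (YM ladder rung R3 = continuum `SU(2)` Yang–Mills on the three-torus — a RUNG, NOT d = 4, NOT infinite volume, NOT a mass gap, NOT Clay).  Width seat
`ym-ust-20520-w3` (gen 20, LEAD-20520 by lineage); `--supports stmt-QuantumFields-20520 --as helper`, count-neutral, definition-free, default heartbeats, Mathlib-only imports.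

WHAT.  Ideator `ym-r3-idea-1` g24's LINE g24-3 «polymer_form» (`Cruxes/FluctuationComparisonRegPrIntL/Lines/polymer_form.lean`, crux workfile, not importable) reads the
S2β organ `FluctuationPartSmall` of PATH B through print's OUTPUT FORM: the fluctuation part of the window density is a LOCALIZED SUM `f = c₀ + Σ_X T(X,·)` over finite bond sets
`X`, `T(X,·)` depending on the configuration restricted to `X` ([Balaban1987RG1] (0.24)–(0.25) p.257; [Balaban1989LargeFieldII] (1.98)–(1.100) p.390), with window
oscillations `|T X U − T X V| ≤ w X`.  This file is the MODEL-FREE algebra behind that reading, for ANY finite index type `ι` («bonds»), ANY value type `G`, ANY window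
`S ⊆ (ι → G)`:
* §1 (lifted BY TEXT from the ideator's §2, proofs byte-identical — credit ym-r3-idea-1 g24): `onePoint_le_pinnedSum` (one pin: terms whose support misses the moved bond
  cancel, `|f U − f V| ≤ Σ_{X ∋ b} w X`), `fourPoint_le_pinnedSum` (two pins: a term missing `b` OR `b′` cancels in the connected 4-point,
  `|(fU − fV) − (fW − fZ)| ≤ Σ_{X ∋ b, b′} 2·w X`), `tendsto_mul_two_of_superpoly`.
* §2 (NEW): the standard «‖·‖_κ POLYMER NORM ⇒ PINNED SUMS» step of cluster expansions — if the weights are non-negative and ONE weighted one-pin sum is bounded,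
  `Σ_{X ∋ b} w X · e^{κ·D X} ≤ Φ` for a size function `D` dominating a pair function `d` on every polymer (`e, e′ ∈ X ⇒ d e e′ ≤ D X`; e.g. `D` = diameter or tree length,
  `d` = distance), then BOTH pinned clauses of the ideator's row POLY∘ follow with the SAME constants: `pinnedSum_le_of_normSum` (`Σ_{X ∋ b} w X ≤ Φ`, for `0 ≤ κ·D`) and
  `twoPinnedSum_le_of_normSum` (`Σ_{X ∋ b, b′} w X ≤ Φ·e^{−κ·d b b′}`).  This is the shape in which print states its bounds ((0.25): a per-term `e^{−κ d_j(X)}` against a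
  lattice-animal one-pin resummation (1.26) of [Balaban1988RG2Cluster] p.8), and the reason POLY∘'s two summed clauses are ONE clause in print's currency.
* §3 (v1.1 APPEND, LINE g24-3 v2 c161520e ∕ idea-crit-5 #476-P2): `onePoint_le_pinnedSum_oneBond`, `fourPoint_le_pinnedSum_oneBond` — §1 with the oscillation weight
  asked only for window pairs agreeing off ONE bond (the only pairs the pin algebra feeds it).
Consumers: `Theorems/FluctuationComparisonRegPrIntLPolymerNormKnit.lean` (the junctions POLYⁿ∘ → POLY∘ → S2β ∕ GRAD∘ with the organ texts inline).

HONEST SCOPE.  Finite-sum inequalities only; nothing of Bałaban's is asserted or proved; POLY∘ ∕ POLYⁿ∘ ∕ S2β ∕ GRAD∘ ∕ `FluctuationComparisonRegPrIntL` (20520) NOT proved; no summit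
is proved by a helper; rung R3 = SU(2) YM₃ on T³ — NOT d = 4, NOT infinite volume, NOT a mass gap, NOT Clay.  Sorry-free, axioms standard.

References: T. Bałaban, CMP **109** (1987) 249–301 [Balaban1987RG1] ((0.24)–(0.25) p.257); CMP **116** (1988) 1–22 [Balaban1988RG2Cluster] ((1.26) p.8); CMP **122** (1989)
355–392 [Balaban1989LargeFieldII] ((1.98)–(1.100) p.390).
-/

set_option autoImplicit false

noncomputable section

namespace Summit.QuantumFields.YangMills.Theorems.FluctuationComparisonRegPrIntLPolymerPinAlgebra

open Filter Topology
open scoped BigOperators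

/-! ## §1 Pinned cancellation in a localized sum (the ideator's §2, lifted by text) -/

/-- **ONE PIN**: in a localized sum `f = c₀ + Σ_X T X` on the window `S`, the terms whose support misses the moved bond `b` cancel in `f U − f V`, so
`|f U − f V| ≤ Σ_{X ∋ b} w X`.  Lifted by text from ideator ym-r3-idea-1 g24's `Lines/polymer_form.lean` §2. [cite: Balaban1987RG1, (0.24)-(0.25) p.257] -/
theorem onePoint_le_pinnedSum {ι G : Type*} [Fintype ι] [DecidableEq ι] (T : Finset ι → (ι → G) → ℝ) (w : Finset ι → ℝ) (S : Set (ι → G)) (c₀ : ℝ)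
    (f : (ι → G) → ℝ)
    (hloc : ∀ X U V, (∀ e ∈ X, U e = V e) → T X U = T X V)
    (hosc : ∀ X U V, U ∈ S → V ∈ S → |T X U - T X V| ≤ w X)
    (hrep : ∀ U, U ∈ S → f U = c₀ + ∑ X, T X U)
    (b : ι) (U V : ι → G) (hU : U ∈ S) (hV : V ∈ S) (hUV : ∀ e, e ≠ b → U e = V e) :
    |f U - f V| ≤ ∑ X ∈ Finset.univ.filter (fun X => b ∈ X), w X := by
  have hdiff : f U - f V = ∑ X, (T X U - T X V) := by
    rw [hrep U hU, hrep V hV, Finset.sum_sub_distrib]; ring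
  have hsplit := Finset.sum_filter_add_sum_filter_not Finset.univ (fun X => b ∈ X) (fun X => T X U - T X V)
  have hzero : ∑ X ∈ Finset.univ.filter (fun X => ¬ b ∈ X), (T X U - T X V) = 0 := by
    refine Finset.sum_eq_zero ?_
    intro X hX
    have hb : b ∉ X := (Finset.mem_filter.mp hX).2
    have : T X U = T X V := hloc X U V (fun e he => hUV e (by rintro rfl; exact hb he))
    rw [this, sub_self]
  rw [hdiff, ← hsplit, hzero, add_zero]
  refine (Finset.abs_sum_le_sum_abs _ _).trans ?_
  exact Finset.sum_le_sum (fun X _ => hosc X U V hU hV)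

/-- **TWO PINS**: in the connected 4-point of a localized sum over the quadrilateral `U, V, W, Z` (`U∕V` and `W∕Z` differ at `b` only; `U∕W` and `V∕Z` at `b′` only) a term
missing `b` OR `b′` cancels, so `|(fU − fV) − (fW − fZ)| ≤ Σ_{X ∋ b, b′} 2·w X`.  Lifted by text from ideator ym-r3-idea-1 g24's `Lines/polymer_form.lean` §2.
[cite: Balaban1987RG1, (0.24)-(0.25) p.257] -/
theorem fourPoint_le_pinnedSum {ι G : Type*} [Fintype ι] [DecidableEq ι] (T : Finset ι → (ι → G) → ℝ) (w : Finset ι → ℝ) (S : Set (ι → G)) (c₀ : ℝ)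
    (f : (ι → G) → ℝ)
    (hloc : ∀ X U V, (∀ e ∈ X, U e = V e) → T X U = T X V)
    (hosc : ∀ X U V, U ∈ S → V ∈ S → |T X U - T X V| ≤ w X)
    (hrep : ∀ U, U ∈ S → f U = c₀ + ∑ X, T X U)
    (b b' : ι) (U V W Z : ι → G) (hU : U ∈ S) (hV : V ∈ S) (hW : W ∈ S) (hZ : Z ∈ S)
    (hUV : ∀ e, e ≠ b → U e = V e) (hUW : ∀ e, e ≠ b' → U e = W e) (hVZ : ∀ e, e ≠ b' → V e = Z e) (hWZ : ∀ e, e ≠ b → W e = Z e) :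
    |(f U - f V) - (f W - f Z)| ≤ ∑ X ∈ Finset.univ.filter (fun X => b ∈ X ∧ b' ∈ X), 2 * w X := by
  have hdiff : (f U - f V) - (f W - f Z) = ∑ X, ((T X U - T X V) - (T X W - T X Z)) := by
    rw [hrep U hU, hrep V hV, hrep W hW, hrep Z hZ]
    simp only [Finset.sum_sub_distrib]; ring
  have hsplit := Finset.sum_filter_add_sum_filter_not Finset.univ (fun X => b ∈ X ∧ b' ∈ X)
    (fun X => (T X U - T X V) - (T X W - T X Z))
  have hzero : ∑ X ∈ Finset.univ.filter (fun X => ¬ (b ∈ X ∧ b' ∈ X)), ((T X U - T X V) - (T X W - T X Z)) = 0 := by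
    refine Finset.sum_eq_zero ?_
    intro X hX
    have hbb : ¬ (b ∈ X ∧ b' ∈ X) := (Finset.mem_filter.mp hX).2
    by_cases hb : b ∈ X
    · have hb' : b' ∉ X := fun h => hbb ⟨hb, h⟩
      have h1 : T X U = T X W := hloc X U W (fun e he => hUW e (by rintro rfl; exact hb' he))
      have h2 : T X V = T X Z := hloc X V Z (fun e he => hVZ e (by rintro rfl; exact hb' he))
      rw [h1, h2]; ring
    · have h1 : T X U = T X V := hloc X U V (fun e he => hUV e (by rintro rfl; exact hb he))
      have h2 : T X W = T X Z := hloc X W Z (fun e he => hWZ e (by rintro rfl; exact hb he))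
      rw [h1, h2]; ring
  rw [hdiff, ← hsplit, hzero, add_zero]
  refine (Finset.abs_sum_le_sum_abs _ _).trans ?_
  refine Finset.sum_le_sum (fun X _ => ?_)
  calc |(T X U - T X V) - (T X W - T X Z)| ≤ |T X U - T X V| + |T X W - T X Z| := abs_sub _ _
    _ ≤ w X + w X := add_le_add (hosc X U V hU hV) (hosc X W Z hW hZ)
    _ = 2 * w X := by ring

/-- Super-polynomial decay of `φ` ⇒ S2β's modulus for the doubled weight: `J·(2φ_J) → 0`.  Lifted by text from ideator ym-r3-idea-1 g24's `Lines/polymer_form.lean` §2.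
[cite: Balaban1985UV3, Thm 2 p.263] -/
theorem tendsto_mul_two_of_superpoly {φ : ℕ → ℝ} (hφ0 : ∀ J, 0 ≤ φ J)
    (hφ : ∀ a : ℕ, Tendsto (fun J : ℕ => ((J : ℝ) + 1) ^ a * φ J) atTop (𝓝 0)) :
    Tendsto (fun J : ℕ => (J : ℝ) * (2 * φ J)) atTop (𝓝 0) := by
  have h1 : Tendsto (fun J : ℕ => 2 * (((J : ℝ) + 1) ^ 1 * φ J)) atTop (𝓝 0) := by
    simpa using (hφ 1).const_mul 2
  refine tendsto_of_tendsto_of_tendsto_of_le_of_le tendsto_const_nhds h1 (fun J => ?_) (fun J => ?_)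
  · exact mul_nonneg (Nat.cast_nonneg J) (mul_nonneg (by norm_num) (hφ0 J))
  · have := hφ0 J
    have hJ : (0 : ℝ) ≤ J := Nat.cast_nonneg J
    nlinarith

/-! ## §2 NEW: the polymer norm controls both pinned sums -/

/-- **POLYMER NORM ⇒ ONE-PIN SUM**: if the weights are non-negative, the size function is non-negative on polymers through `b` and `0 ≤ κ`, then the weighted one-pin
bound `Σ_{X ∋ b} w X · e^{κ·D X} ≤ Φ` gives the bare one `Σ_{X ∋ b} w X ≤ Φ` (`e^{κ·D X} ≥ 1`). [cite: Balaban1988RG2Cluster, (1.26) p.8] -/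
theorem pinnedSum_le_of_normSum {ι : Type*} [Fintype ι] [DecidableEq ι] (w D : Finset ι → ℝ) {κ Φ : ℝ} (hκ : 0 ≤ κ)
    (hw : ∀ X, 0 ≤ w X) (b : ι) (hD : ∀ X, b ∈ X → 0 ≤ D X)
    (hnorm : ∑ X ∈ Finset.univ.filter (fun X => b ∈ X), w X * Real.exp (κ * D X) ≤ Φ) :
    ∑ X ∈ Finset.univ.filter (fun X => b ∈ X), w X ≤ Φ := by
  refine le_trans (Finset.sum_le_sum fun X hX => ?_) hnorm
  have hbX : b ∈ X := (Finset.mem_filter.mp hX).2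
  have h1 : (1 : ℝ) ≤ Real.exp (κ * D X) := Real.one_le_exp (mul_nonneg hκ (hD X hbX))
  calc w X = w X * 1 := (mul_one _).symm
    _ ≤ w X * Real.exp (κ * D X) := mul_le_mul_of_nonneg_left h1 (hw X)

/-- **POLYMER NORM ⇒ TWO-PIN SUM WITH DECAY**: if the weights are non-negative and the pair function `d` is dominated on every polymer by the size function `D`
(`e, e′ ∈ X ⇒ d e e′ ≤ D X`), then the weighted one-pin bound `Σ_{X ∋ b} w X · e^{κ·D X} ≤ Φ` (any real `κ ≥ 0`) gives the two-pin clause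
`Σ_{X ∋ b, b′} w X ≤ Φ · e^{−κ·d b b′}`: on a polymer through both pins `e^{κ·d b b′} ≤ e^{κ·D X}`, and the two-pin family is a sub-family of the one-pin family.
[cite: Balaban1988RG2Cluster, (1.26) p.8] -/
theorem twoPinnedSum_le_of_normSum {ι : Type*} [Fintype ι] [DecidableEq ι] (w D : Finset ι → ℝ) (d : ι → ι → ℝ) {κ Φ : ℝ} (hκ : 0 ≤ κ)
    (hw : ∀ X, 0 ≤ w X) (hdD : ∀ X, ∀ e ∈ X, ∀ e' ∈ X, d e e' ≤ D X) (b b' : ι)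
    (hnorm : ∑ X ∈ Finset.univ.filter (fun X => b ∈ X), w X * Real.exp (κ * D X) ≤ Φ) :
    ∑ X ∈ Finset.univ.filter (fun X => b ∈ X ∧ b' ∈ X), w X ≤ Φ * Real.exp (-(κ * d b b')) := by
  have hΦ : 0 ≤ Φ := le_trans (Finset.sum_nonneg fun X _ => mul_nonneg (hw X) (Real.exp_nonneg _)) hnorm
  -- termwise: on a polymer through both pins, `w X ≤ w X · e^{κ D X} · e^{−κ d b b′}`
  have hpt : ∀ X ∈ Finset.univ.filter (fun X => b ∈ X ∧ b' ∈ X),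
      w X ≤ w X * Real.exp (κ * D X) * Real.exp (-(κ * d b b')) := by
    intro X hX
    obtain ⟨hb, hb'⟩ := (Finset.mem_filter.mp hX).2
    have hle : κ * d b b' ≤ κ * D X := mul_le_mul_of_nonneg_left (hdD X b hb b' hb') hκ
    have h1 : (1 : ℝ) ≤ Real.exp (κ * D X) * Real.exp (-(κ * d b b')) := by
      rw [← Real.exp_add]
      exact Real.one_le_exp (by linarith)
    calc w X = w X * 1 := (mul_one _).symm
      _ ≤ w X * (Real.exp (κ * D X) * Real.exp (-(κ * d b b'))) := mul_le_mul_of_nonneg_left h1 (hw X)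
      _ = w X * Real.exp (κ * D X) * Real.exp (-(κ * d b b')) := by ring
  calc ∑ X ∈ Finset.univ.filter (fun X => b ∈ X ∧ b' ∈ X), w X
      ≤ ∑ X ∈ Finset.univ.filter (fun X => b ∈ X ∧ b' ∈ X), w X * Real.exp (κ * D X) * Real.exp (-(κ * d b b')) :=
        Finset.sum_le_sum hpt
    _ = (∑ X ∈ Finset.univ.filter (fun X => b ∈ X ∧ b' ∈ X), w X * Real.exp (κ * D X)) * Real.exp (-(κ * d b b')) := by
        rw [Finset.sum_mul]
    _ ≤ (∑ X ∈ Finset.univ.filter (fun X => b ∈ X), w X * Real.exp (κ * D X)) * Real.exp (-(κ * d b b')) := by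
        refine mul_le_mul_of_nonneg_right ?_ (Real.exp_nonneg _)
        refine Finset.sum_le_sum_of_subset_of_nonneg (fun X hX => ?_) (fun X _ _ => mul_nonneg (hw X) (Real.exp_nonneg _))
        obtain ⟨hu, hb, -⟩ := Finset.mem_filter.mp hX
        exact Finset.mem_filter.mpr ⟨hu, hb⟩
    _ ≤ Φ * Real.exp (-(κ * d b b')) := mul_le_mul_of_nonneg_right hnorm (Real.exp_nonneg _)

/-- **THE DIAMETER DOMINATES THE PAIR FUNCTION** (the instance of `hdD` used by the consumers): for a pair function `dist : ι → ι → ℕ`, the polymer's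
`sup`-diameter `X.sup (e ↦ X.sup (e′ ↦ dist e e′))` bounds `dist e e′` for all `e, e′ ∈ X` (cast to `ℝ`). [folklore] -/
theorem cast_dist_le_cast_supDiam {ι : Type*} (dist : ι → ι → ℕ) (X : Finset ι) {e e' : ι} (he : e ∈ X) (he' : e' ∈ X) :
    (dist e e' : ℝ) ≤ ((X.sup fun a => X.sup fun a' => dist a a' : ℕ) : ℝ) := by
  have h1 : dist e e' ≤ X.sup fun a' => dist e a' := Finset.le_sup (f := fun a' => dist e a') he'
  have h2 : (X.sup fun a' => dist e a') ≤ X.sup fun a => X.sup fun a' => dist a a' :=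
    Finset.le_sup (f := fun a => X.sup fun a' => dist a a') he
  exact_mod_cast h1.trans h2

/-! ## §3 The ONE-BOND editions of §1 (LINE g24-3 v2, idea-crit-5 #476-P2): the oscillation weight is only asked for window pairs agreeing off one bond -/

/-- **ONE PIN, ONE-BOND OSCILLATION HYPOTHESIS** (v2 of `onePoint_le_pinnedSum`, the form of ideator g24-3's `Lines/polymer_form.lean` v2 c161520e §2): the weight `w X`
need only dominate `|T X U − T X V|` for window pairs `U, V` that AGREE OFF ONE BOND (any bond) — the only pairs the pin algebra feeds it (= print's per-direction
Schwarz bound); conclusion unchanged: `|f U − f V| ≤ Σ_{X ∋ b} w X` for `U, V` agreeing off `b`. Proof lifted by text (credit ym-r3-idea-1 g24).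
[cite: Balaban1987RG1, (0.24)-(0.25) p.257 and (1.11)-(1.14) p.262] -/
theorem onePoint_le_pinnedSum_oneBond {ι G : Type*} [Fintype ι] [DecidableEq ι] (T : Finset ι → (ι → G) → ℝ) (w : Finset ι → ℝ) (S : Set (ι → G)) (c₀ : ℝ)
    (f : (ι → G) → ℝ)
    (hloc : ∀ X U V, (∀ e ∈ X, U e = V e) → T X U = T X V)
    (hosc : ∀ X (b : ι) U V, U ∈ S → V ∈ S → (∀ e, e ≠ b → U e = V e) → |T X U - T X V| ≤ w X)
    (hrep : ∀ U, U ∈ S → f U = c₀ + ∑ X, T X U)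
    (b : ι) (U V : ι → G) (hU : U ∈ S) (hV : V ∈ S) (hUV : ∀ e, e ≠ b → U e = V e) :
    |f U - f V| ≤ ∑ X ∈ Finset.univ.filter (fun X => b ∈ X), w X := by
  have hdiff : f U - f V = ∑ X, (T X U - T X V) := by
    rw [hrep U hU, hrep V hV, Finset.sum_sub_distrib]; ring
  have hsplit := Finset.sum_filter_add_sum_filter_not Finset.univ (fun X => b ∈ X) (fun X => T X U - T X V)
  have hzero : ∑ X ∈ Finset.univ.filter (fun X => ¬ b ∈ X), (T X U - T X V) = 0 := by
    refine Finset.sum_eq_zero ?_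
    intro X hX
    have hb : b ∉ X := (Finset.mem_filter.mp hX).2
    have : T X U = T X V := hloc X U V (fun e he => hUV e (by rintro rfl; exact hb he))
    rw [this, sub_self]
  rw [hdiff, ← hsplit, hzero, add_zero]
  refine (Finset.abs_sum_le_sum_abs _ _).trans ?_
  exact Finset.sum_le_sum (fun X _ => hosc X b U V hU hV hUV)

/-- **TWO PINS, ONE-BOND OSCILLATION HYPOTHESIS** (v2 of `fourPoint_le_pinnedSum`, ideator g24-3 `Lines/polymer_form.lean` v2 §2): in the connected 4-point over the
quadrilateral `U∕V` (differ at `b`), `W∕Z` (differ at `b`), `U∕W`, `V∕Z` (differ at `b′`), a term missing `b` OR `b′` cancels and the two surviving differences are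
ONE-BOND pairs, so the one-bond weight suffices: `|(fU − fV) − (fW − fZ)| ≤ Σ_{X ∋ b, b′} 2·w X`. Proof lifted by text (credit ym-r3-idea-1 g24).
[cite: Balaban1987RG1, (0.24)-(0.25) p.257 and (1.11)-(1.14) p.262] -/
theorem fourPoint_le_pinnedSum_oneBond {ι G : Type*} [Fintype ι] [DecidableEq ι] (T : Finset ι → (ι → G) → ℝ) (w : Finset ι → ℝ) (S : Set (ι → G)) (c₀ : ℝ)
    (f : (ι → G) → ℝ)
    (hloc : ∀ X U V, (∀ e ∈ X, U e = V e) → T X U = T X V)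
    (hosc : ∀ X (b : ι) U V, U ∈ S → V ∈ S → (∀ e, e ≠ b → U e = V e) → |T X U - T X V| ≤ w X)
    (hrep : ∀ U, U ∈ S → f U = c₀ + ∑ X, T X U)
    (b b' : ι) (U V W Z : ι → G) (hU : U ∈ S) (hV : V ∈ S) (hW : W ∈ S) (hZ : Z ∈ S)
    (hUV : ∀ e, e ≠ b → U e = V e) (hUW : ∀ e, e ≠ b' → U e = W e) (hVZ : ∀ e, e ≠ b' → V e = Z e) (hWZ : ∀ e, e ≠ b → W e = Z e) :
    |(f U - f V) - (f W - f Z)| ≤ ∑ X ∈ Finset.univ.filter (fun X => b ∈ X ∧ b' ∈ X), 2 * w X := by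
  have hdiff : (f U - f V) - (f W - f Z) = ∑ X, ((T X U - T X V) - (T X W - T X Z)) := by
    rw [hrep U hU, hrep V hV, hrep W hW, hrep Z hZ]
    simp only [Finset.sum_sub_distrib]; ring
  have hsplit := Finset.sum_filter_add_sum_filter_not Finset.univ (fun X => b ∈ X ∧ b' ∈ X)
    (fun X => (T X U - T X V) - (T X W - T X Z))
  have hzero : ∑ X ∈ Finset.univ.filter (fun X => ¬ (b ∈ X ∧ b' ∈ X)), ((T X U - T X V) - (T X W - T X Z)) = 0 := by
    refine Finset.sum_eq_zero ?_
    intro X hX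
    have hbb : ¬ (b ∈ X ∧ b' ∈ X) := (Finset.mem_filter.mp hX).2
    by_cases hb : b ∈ X
    · have hb' : b' ∉ X := fun h => hbb ⟨hb, h⟩
      have h1 : T X U = T X W := hloc X U W (fun e he => hUW e (by rintro rfl; exact hb' he))
      have h2 : T X V = T X Z := hloc X V Z (fun e he => hVZ e (by rintro rfl; exact hb' he))
      rw [h1, h2]; ring
    · have h1 : T X U = T X V := hloc X U V (fun e he => hUV e (by rintro rfl; exact hb he))
      have h2 : T X W = T X Z := hloc X W Z (fun e he => hWZ e (by rintro rfl; exact hb he))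
      rw [h1, h2]; ring
  rw [hdiff, ← hsplit, hzero, add_zero]
  refine (Finset.abs_sum_le_sum_abs _ _).trans ?_
  refine Finset.sum_le_sum (fun X _ => ?_)
  calc |(T X U - T X V) - (T X W - T X Z)| ≤ |T X U - T X V| + |T X W - T X Z| := abs_sub _ _
    _ ≤ w X + w X := add_le_add (hosc X b U V hU hV hUV) (hosc X b W Z hW hZ hWZ)
    _ = 2 * w X := by ring

end Summit.QuantumFields.YangMills.Theorems.FluctuationComparisonRegPrIntLPolymerPinAlgebra

end
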